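import Summits.AtomisticToContinuum.HydrodynamicLimit.Theorems.CollisionIsometryCLTAdaptedWeightCLTContactBalance
import Summits.AtomisticToContinuum.HydrodynamicLimit.Theorems.CollisionIsometryCLTAdaptedWeightCLTTLPastDampingKernel

/-!
# Stub `stub_lipschitz` of the line `Sketch` (contact-balance composition) for the crux
`AdaptedWeightCLT` (stmt-AtomisticToContinuum-14868; `--supports`)

`L²ₓ`-LIPSCHITZ ESTIMATE of the twelve block-field components `(D_{jk}, q_a)` along free flight
(`FreeFlightLipschitz γ φ σ`) from the pointwise increment bound `PointwiseFreeFlight γ φ`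
(landed as `stub_pointwise`): SUP × `L¹`.

Pointwise, each increment is at most `b(x) = A (N+1)^{4γ} r (1+v_max)⁴ (N+1)⁻¹ (n_w(x) + n_{w'}(x))`
with `n_w(x) = #{i : d(x_i, x) < R}`, `R = (N+1)^{-γ}`, `w' = freeFlight r w`, so the integrand `F`
of `l2dist² = ∫ₓ F` is at most `12 b²`.
* SUP: on the hard-sphere domain (diameter `ε_N = σ (N+1)^{-1/3}`) the packing bound
  `PastDamping.card_filter_near_le` gives `n ≤ (2R/ε_N + 1)³ ≤ 27 R³/ε_N³ = 27 σ⁻³ R³ (N+1)`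
  (`ε_N ≤ R` because `γ ≤ 1/15 < 1/3`, `σ < 1/2`; `R + ε_N/2 < 1/2` for `N ≥ N₀`);
* `L¹`: `∫ₓ n_w(x) dx = Σ_i vol{d(·, x_i) < R} = (N+1) R³ |B₁|` (`PastDamping.volumeReal_euclidDist_lt`);
* `∫ F ≤ 12 sup(b) ∫ b` (no integrability of `F` needed, `integral_mono_of_nonneg`), and the powers of
  `N+1` collect to `(N+1)^{2γ}`: `l2dist ≤ 36 |A| (|B₁|/σ³)^{1/2} (N+1)^γ (1+v_max)⁴ r`.
-/

namespace Summit.AtomisticToContinuum.HydrodynamicLimit.Theorems.ContactBalance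

open scoped BigOperators Topology Classical MeasureTheory ENNReal InnerProductSpace
open Filter Set MeasureTheory
open Literature.Analysis.FluidPDE
open Summit.AtomisticToContinuum.HydrodynamicLimit.Theorems.ContactSourceDuhamel
open Summit.AtomisticToContinuum.HydrodynamicLimit.Theorems.ContactSourceDuhamel.TimeLocal
open Literature.MathematicalPhysics.KineticTheory (hsDiameter hsDiameter_pos hsDiameter_le)

noncomputable section

namespace Lipschitz

variable {N : ℕ}

/-! ## The block count: indicator form, integral, packing bound -/

/-- The block count, cast to `ℝ`, is the sum over the particles of the indicators of the
minimal-image balls of radius `R` about them. -/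
theorem blockCount_eq_sum_indicator (R : ℝ) (w : Cfg N) (x : T3) :
    (blockCount N R w x : ℝ) =
      ∑ i, {y : T3 | Torus.euclidDist y (w i).1 < R}.indicator (1 : T3 → ℝ) x := by
  unfold blockCount
  rw [Finset.natCast_card_filter]
  refine Finset.sum_congr rfl fun i _ => ?_
  by_cases h : Torus.euclidDist (w i).1 x < R
  · rw [if_pos h, Set.indicator_of_mem, Pi.one_apply]
    rw [Set.mem_setOf_eq, Torus.euclidDist_comm]
    exact h
  · rw [if_neg h, Set.indicator_of_notMem]
    rw [Set.mem_setOf_eq, Torus.euclidDist_comm]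
    exact h

/-- The block count is integrable in `x` (a finite sum of indicators of measurable balls). -/
theorem integrable_blockCount (R : ℝ) (w : Cfg N) :
    Integrable fun x => (blockCount N R w x : ℝ) := by
  have h : (fun x => (blockCount N R w x : ℝ)) =
      fun x => ∑ i, {y : T3 | Torus.euclidDist y (w i).1 < R}.indicator (1 : T3 → ℝ) x :=
    funext fun x => blockCount_eq_sum_indicator R w x
  rw [h]
  exact integrable_finsetSum _ fun i _ =>
    (integrable_const (1 : ℝ)).indicator (PastDamping.measurableSet_euclidDist_lt _ _)

/-- `∫ₓ n_w(x) dx = (N+1) R³ |B₁|` for `0 < R < 1/2` (sum and integral swapped; the Haar volume of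
a small minimal-image ball is Euclidean). -/
theorem integral_blockCount {R : ℝ} (hR : 0 < R) (hR' : R < 1 / 2) (w : Cfg N) :
    ∫ x, (blockCount N R w x : ℝ) = ((N + 1 : ℕ) : ℝ) * (R ^ 3 * PastDamping.ballVol) := by
  simp_rw [blockCount_eq_sum_indicator]
  rw [integral_finsetSum Finset.univ
    (f := fun i x => {y : T3 | Torus.euclidDist y (w i).1 < R}.indicator (1 : T3 → ℝ) x)
    fun i _ => (integrable_const (1 : ℝ)).indicator (PastDamping.measurableSet_euclidDist_lt _ _)]
  rw [Finset.sum_congr rfl fun i _ =>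
      show ∫ x, {y : T3 | Torus.euclidDist y (w i).1 < R}.indicator (1 : T3 → ℝ) x =
          R ^ 3 * PastDamping.ballVol by
        rw [integral_indicator_one (PastDamping.measurableSet_euclidDist_lt _ _), measureReal_def,
          PastDamping.volumeReal_euclidDist_lt _ hR hR'],
    Finset.sum_const, Finset.card_univ, Fintype.card_fin, nsmul_eq_mul]

/-- HARD-CORE PACKING: on the hard-sphere domain of diameter `ε`, `n_w(x) ≤ (2R/ε + 1)³`
(`PastDamping.card_filter_near_le`; the domain gives mutual minimal-image distances `≥ ε`). -/
theorem blockCount_le {ε R : ℝ} {w : Cfg N}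
    (hw : w ∈ hardSphereDomain (Torus.geometry (Fin 3)) (N + 1) ε)
    (hε : 0 < ε) (hR : 0 ≤ R) (hhalf : R + ε / 2 < 1 / 2) (x : T3) :
    (blockCount N R w x : ℝ) ≤ (2 * R / ε + 1) ^ 3 := by
  have hsep : ∀ i ∈ (Finset.univ : Finset (Fin (N + 1))), ∀ j ∈ (Finset.univ : Finset (Fin (N + 1))),
      i ≠ j → ε ≤ Torus.euclidDist (w i).1 (w j).1 := by
    intro i _ j _ hij
    have h := (mem_hardSphereDomain.1 hw) i j hij
    rwa [Torus.norm_geometry_sepVec] at h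
  exact PastDamping.card_filter_near_le Finset.univ (fun i => (w i).1) x hε hR hhalf hsep

/-! ## SUP × L¹ -/

/-- SUP × `L¹`: if `0 ≤ F ≤ c b²` pointwise with `0 ≤ b ≤ B` and `b` integrable, then
`∫ F ≤ c B ∫ b` (no integrability of `F` is needed: a non-integrable `F` has Bochner integral `0`,
which is what `integral_mono_of_nonneg` allows). -/
theorem integral_le_of_sq_dominated {F b : T3 → ℝ} {c B : ℝ} (hc : 0 ≤ c)
    (hF : ∀ x, F x ≤ c * b x ^ 2) (hF0 : ∀ x, 0 ≤ F x) (hb0 : ∀ x, 0 ≤ b x) (hbB : ∀ x, b x ≤ B)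
    (hbi : Integrable b) : ∫ x, F x ≤ c * B * ∫ x, b x := by
  have hdom : ∀ x, F x ≤ c * B * b x := fun x =>
    calc F x ≤ c * b x ^ 2 := hF x
      _ = c * (b x * b x) := by rw [sq]
      _ ≤ c * (B * b x) := mul_le_mul_of_nonneg_left (mul_le_mul_of_nonneg_right (hbB x) (hb0 x)) hc
      _ = c * B * b x := by rw [mul_assoc]
  calc ∫ x, F x ≤ ∫ x, c * B * b x :=
        integral_mono_of_nonneg (Eventually.of_forall hF0) (hbi.const_mul _) (Eventually.of_forall hdom)
    _ = c * B * ∫ x, b x := integral_const_mul _ _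

/-- SUP × `L¹` for the block counts of two configurations of the hard-sphere domain: if
`0 ≤ F ≤ c (L (n_w + n_{w'}))²` pointwise, then `∫ F ≤ c · L · 2(2R/ε+1)³ · L · 2(N+1)R³|B₁|`. -/
theorem integral_le_of_blockCount {ε R : ℝ} {w w' : Cfg N}
    (hw : w ∈ hardSphereDomain (Torus.geometry (Fin 3)) (N + 1) ε)
    (hw' : w' ∈ hardSphereDomain (Torus.geometry (Fin 3)) (N + 1) ε)
    (hε : 0 < ε) (hR : 0 < R) (hhalf : R + ε / 2 < 1 / 2) {F : T3 → ℝ} {c L : ℝ} (hc : 0 ≤ c)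
    (hL : 0 ≤ L)
    (hF : ∀ x, F x ≤ c * (L * ((blockCount N R w x : ℝ) + blockCount N R w' x)) ^ 2)
    (hF0 : ∀ x, 0 ≤ F x) :
    ∫ x, F x ≤ c * (L * (2 * (2 * R / ε + 1) ^ 3)) *
      (L * (2 * (((N + 1 : ℕ) : ℝ) * (R ^ 3 * PastDamping.ballVol)))) := by
  have hR2 : R < 1 / 2 := by linarith
  have hbi : Integrable fun x => L * ((blockCount N R w x : ℝ) + blockCount N R w' x) :=
    ((integrable_blockCount R w).fun_add (integrable_blockCount R w')).const_mul L
  have hint : ∫ x, L * ((blockCount N R w x : ℝ) + blockCount N R w' x) =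
      L * (2 * (((N + 1 : ℕ) : ℝ) * (R ^ 3 * PastDamping.ballVol))) := by
    rw [integral_const_mul, integral_add (integrable_blockCount R w) (integrable_blockCount R w'),
      integral_blockCount hR hR2, integral_blockCount hR hR2]
    ring
  rw [← hint]
  refine integral_le_of_sq_dominated hc hF hF0 (fun x => by positivity) (fun x => ?_) hbi
  have h1 := blockCount_le hw hε hR.le hhalf x
  have h2 := blockCount_le hw' hε hR.le hhalf x
  exact mul_le_mul_of_nonneg_left (by linarith) hL

/-- SQUARES: if the twelve increments are at most `b`, the integrand of `l2dist²` is at most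
`12 b²`. -/
theorem defect_increment_sq_le (φ : ℕ → T3 → ℝ) (w w' : Cfg N) (x : T3) {b : ℝ}
    (h2 : ∀ j k : Fin 3, |blkC 2 N φ w' x (C2 j k) - blkC 2 N φ w x (C2 j k)| ≤ b)
    (h3 : ∀ a : Fin 3, |blkC 3 N φ w' x (C3 a) - blkC 3 N φ w x (C3 a)| ≤ b) :
    (∑ j : Fin 3, ∑ k : Fin 3, (blkC 2 N φ w' x (C2 j k) - blkC 2 N φ w x (C2 j k)) ^ 2) +
        ∑ a : Fin 3, (blkC 3 N φ w' x (C3 a) - blkC 3 N φ w x (C3 a)) ^ 2 ≤ 12 * b ^ 2 := by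
  have hsq : ∀ {t : ℝ}, |t| ≤ b → t ^ 2 ≤ b ^ 2 := fun ht => sq_le_sq.2 (ht.trans (le_abs_self _))
  have hS2 : ∑ j : Fin 3, ∑ k : Fin 3, (blkC 2 N φ w' x (C2 j k) - blkC 2 N φ w x (C2 j k)) ^ 2 ≤
      ∑ _j : Fin 3, ∑ _k : Fin 3, b ^ 2 :=
    Finset.sum_le_sum fun j _ => Finset.sum_le_sum fun k _ => hsq (h2 j k)
  have hS3 : ∑ a : Fin 3, (blkC 3 N φ w' x (C3 a) - blkC 3 N φ w x (C3 a)) ^ 2 ≤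
      ∑ _a : Fin 3, b ^ 2 :=
    Finset.sum_le_sum fun a _ => hsq (h3 a)
  simp only [Finset.sum_const, Finset.card_univ, Fintype.card_fin, nsmul_eq_mul, Nat.cast_ofNat] at hS2 hS3
  linarith

end Lipschitz

open Lipschitz in
/-- STUB 2 (pointwise ⇒ `L²ₓ`-Lipschitz: squares, the hard-core density cap
`#{i : d(x_i, x) < R} ≤ (2R/ε + 1)³ ≤ 27 σ⁻³ (N+1)^{1−3γ}` at both endpoint configurations
(`PastDamping.card_filter_near_le`), `∫ₓ n(x) dx = (N+1) vol B_R = (N+1)|B₁|(N+1)^{−3γ}`). -/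
theorem stub_lipschitz : ∀ (γ C : ℝ) (φ : ℕ → T3 → ℝ), 0 < γ → γ ≤ 1 / 15 → AdmissibleKernel γ C φ →
    ∀ σ : ℝ, 0 < σ → σ < 2⁻¹ → PointwiseFreeFlight γ φ → FreeFlightLipschitz γ φ σ := by
  intro γ C φ hγ hγ' _ σ hσ hσ' hpt
  obtain ⟨A, hA⟩ := hpt
  -- `N₀`: `(N+1)^{-γ} < 1/4` beyond it
  obtain ⟨N₀, hN₀⟩ := Filter.eventually_atTop.1
    ((tendsto_order.1 ((tendsto_rpow_neg_atTop hγ).comp tendsto_natCast_atTop_atTop)).2 (1 / 4)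
      (by norm_num))
  refine ⟨Real.sqrt (1296 * PastDamping.ballVol / σ ^ 3) * |A|, N₀, fun N hN w r hr hw hw' => ?_⟩
  have hAx := fun x => hA N w r x hr
  have hR4 : ((N + 1 : ℕ) : ℝ) ^ (-γ) < 1 / 4 := hN₀ (N + 1) (by omega)
  -- abbreviations
  set M : ℝ := ((N + 1 : ℕ) : ℝ) with hMdef
  set V : ℝ := vmax N w with hVdef
  set w' := freeFlight (Torus.geometry (Fin 3)) r w with hw'def
  set Q : ℝ := 1296 * PastDamping.ballVol / σ ^ 3 with hQdef
  have hM0 : 0 < M := by rw [hMdef]; positivity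
  have hM1 : 1 ≤ M := by rw [hMdef]; exact_mod_cast Nat.succ_pos N
  set R : ℝ := M ^ (-γ) with hRdef
  have hR0 : 0 < R := Real.rpow_pos_of_pos hM0 _
  set ε : ℝ := hsDiameter σ N with hεdef
  have hε0 : 0 < ε := hsDiameter_pos hσ N
  have hεσ : ε ≤ σ := hsDiameter_le hσ.le N
  have hεM : ε = σ * M ^ (-(1 / 3 : ℝ)) := rfl
  have hε3 : ε ^ 3 = σ ^ 3 * M⁻¹ := by
    rw [hεM, mul_pow, ← Real.rpow_natCast (M ^ (-(1 / 3 : ℝ))), ← Real.rpow_mul hM0.le,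
      ← Real.rpow_neg_one]
    norm_num
  have hεR : ε ≤ R := by
    rw [hεM]
    calc σ * M ^ (-(1 / 3 : ℝ)) ≤ 1 * M ^ (-(1 / 3 : ℝ)) :=
          mul_le_mul_of_nonneg_right (by linarith) (Real.rpow_nonneg hM0.le _)
      _ ≤ R := by rw [one_mul]; exact Real.rpow_le_rpow_of_exponent_le hM1 (by linarith)
  have hhalf : R + ε / 2 < 1 / 2 := by linarith
  have hV : 0 ≤ V := (norm_nonneg _).trans (Finset.le_sup' (fun i => ‖(w i).2‖) (Finset.mem_univ 0))
  have hB : 0 ≤ PastDamping.ballVol := PastDamping.ballVol_nonneg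
  have hQ : 0 ≤ Q := by rw [hQdef]; positivity
  -- the prefactor, with `|A|`
  set L : ℝ := |A| * M ^ (4 * γ) * r * (1 + V) ^ 4 * M⁻¹ with hLdef
  have hL : 0 ≤ L := by rw [hLdef]; positivity
  -- pointwise: `F ≤ 12 (L n)²`
  have hF : ∀ x, (∑ j : Fin 3, ∑ k : Fin 3, (blkC 2 N φ w' x (C2 j k) - blkC 2 N φ w x (C2 j k)) ^ 2) +
      ∑ a : Fin 3, (blkC 3 N φ w' x (C3 a) - blkC 3 N φ w x (C3 a)) ^ 2 ≤
      12 * (L * ((blockCount N R w x : ℝ) + blockCount N R w' x)) ^ 2 := by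
    intro x
    obtain ⟨h2, h3⟩ := hAx x
    have hmono : A * M ^ (4 * γ) * r * (1 + V) ^ 4 * M⁻¹ *
        ((blockCount N R w x : ℝ) + blockCount N R w' x) ≤
        L * ((blockCount N R w x : ℝ) + blockCount N R w' x) := by
      have e : ∀ a : ℝ, a * M ^ (4 * γ) * r * (1 + V) ^ 4 * M⁻¹ *
          ((blockCount N R w x : ℝ) + blockCount N R w' x) =
          a * (M ^ (4 * γ) * r * (1 + V) ^ 4 * M⁻¹ * ((blockCount N R w x : ℝ) + blockCount N R w' x)) :=
        fun a => by ring
      rw [hLdef, e A, e |A|]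
      exact mul_le_mul_of_nonneg_right (le_abs_self A) (by positivity)
    exact defect_increment_sq_le φ w w' x (fun j k => (h2 j k).trans hmono) fun a => (h3 a).trans hmono
  -- integrate (SUP × L¹)
  have hI : _ ≤ 12 * (L * (2 * (2 * R / ε + 1) ^ 3)) * (L * (2 * (M * (R ^ 3 * PastDamping.ballVol)))) :=
    integral_le_of_blockCount hw hw' hε0 hR0 hhalf (by norm_num : (0 : ℝ) ≤ 12) hL hF
      fun x => by positivity
  -- bookkeeping: the packing number and the powers of `M`
  have hP : (2 * R / ε + 1) ^ 3 ≤ 27 * R ^ 3 * M / σ ^ 3 := by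
    have h1 : 1 ≤ R / ε := (one_le_div hε0).2 hεR
    have h2 : 2 * R / ε + 1 ≤ 3 * (R / ε) := by rw [mul_div_assoc]; linarith
    calc (2 * R / ε + 1) ^ 3 ≤ (3 * (R / ε)) ^ 3 := pow_le_pow_left₀ (by positivity) h2 3
      _ = 27 * R ^ 3 / ε ^ 3 := by rw [mul_pow, div_pow]; ring
      _ = 27 * R ^ 3 * M / σ ^ 3 := by rw [hε3]; field_simp
  have hMR : M ^ (4 * γ) * M⁻¹ * M * R ^ 3 = M ^ γ := by
    rw [inv_mul_cancel_right₀ hM0.ne', hRdef, ← Real.rpow_natCast (M ^ (-γ)), ← Real.rpow_mul hM0.le,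
      ← Real.rpow_add hM0]
    congr 1
    push_cast
    ring
  have hK0 : 0 ≤ Real.sqrt Q * |A| * M ^ γ * (1 + V) ^ 4 * r := by positivity
  have htarget : ∫ x, ((∑ j : Fin 3, ∑ k : Fin 3,
      (blkC 2 N φ w' x (C2 j k) - blkC 2 N φ w x (C2 j k)) ^ 2) +
        ∑ a : Fin 3, (blkC 3 N φ w' x (C3 a) - blkC 3 N φ w x (C3 a)) ^ 2) ≤
      (Real.sqrt Q * |A| * M ^ γ * (1 + V) ^ 4 * r) ^ 2 :=
    calc _ ≤ _ := hI
      _ = 48 * PastDamping.ballVol * L ^ 2 * M * R ^ 3 * (2 * R / ε + 1) ^ 3 := by ring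
      _ ≤ 48 * PastDamping.ballVol * L ^ 2 * M * R ^ 3 * (27 * R ^ 3 * M / σ ^ 3) :=
          mul_le_mul_of_nonneg_left hP (by positivity)
      _ = Q * (|A| * r * (1 + V) ^ 4 * (M ^ (4 * γ) * M⁻¹ * M * R ^ 3)) ^ 2 := by
          rw [hQdef, hLdef]; ring
      _ = (Real.sqrt Q) ^ 2 * (|A| * M ^ γ * (1 + V) ^ 4 * r) ^ 2 := by
          rw [hMR, Real.sq_sqrt hQ]; ring
      _ = (Real.sqrt Q * |A| * M ^ γ * (1 + V) ^ 4 * r) ^ 2 := by ring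
  -- conclude
  unfold l2dist
  rw [Real.sqrt_le_left hK0]
  exact htarget

end

end Summit.AtomisticToContinuum.HydrodynamicLimit.Theorems.ContactBalance
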